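import Summits.BirchSwinnertonDyer.BirchSwinnertonDyer.Theorems.BiquadraticEisensteinDescentHeegnerTwistCouplingInSupplySymbolicMonskyDesignCore
import HarnessLib

set_option linter.dupNamespace false -- `Summit.BirchSwinnertonDyer.BirchSwinnertonDyer.Theorems.…` (summit = sub)
set_option autoImplicit false

/-!
# Crux `HeegnerTwistCouplingInSupply` (stmt-BirchSwinnertonDyer-21381) — Z-DESIGNS with any number of free cells, part 3: ★★ the DESIGN
# CRITERION — a design whose evaluation map is bijective on the augmented virtual kernel is a pattern-free Heegner recipe (every `k`, every `τ`)

Route `BiquadraticEisensteinDescent` (cell `pub/bsd-wall`, width seat `bsd-wall-cm-bed-w3` g22; `--supports` 21381, helper). File (3/3) of the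
general-`τ` design criterion (memo w3g22 THEOREM-A §2: «one-stage closure ⇔ ρ bijective on 𝒦⁺»); parts 1–2 `…DesignRows`, `…DesignCore`;
the two-cell theorem `…SymbolicMonskyTwoPrime` (w3 g21) is the case `τ = 1`.

THE DESIGN. Base datum `base : SymbData (k+1)` (primes `P₀ … P_k` of `n₀`), `τ` FREE CELLS `rest` (auxiliary primes `q_(i+1) ≡ 1 (mod 4)`,
`(2/·)`-class `d'_i`, symbol vector `σ_i ∈ 𝔽₂^(k+1)` against the base) and the cell `c₁` of `q₁ ≡ 3 (mod 4)` FORCED by Heegner: bits `m + Σ σ_i`,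
`(2/·)`-class `Σ d'_i` (`heegnerK_design`). Write `c_i = |σ_i|`, and let `𝒦` be the virtual kernel of the base (pairs `(x, y)` with
`(L + D_m)x + D_d y = 0`, `D_m x + L y = 0`).
★★ `det_dataK_design_eq_one` / `design_recipe`: IF
 (span) the vectors `(⟨σ_i, y⟩, ⟨σ_i, x⟩)_i` for `(x, y) ∈ 𝒦`, together with `(c_i, d'_i)_i`, have only `0` as common orthogonal in `𝔽₂^τ × 𝔽₂^τ`, and
 (inj) `(x, y) ∈ 𝒦`, `γ ∈ 𝔽₂`, `⟨σ_i, x⟩ = γ d'_i ∀ i`, `⟨σ_i, y⟩ = γ c_i ∀ i` ⇒ `γ = 0 ∧ x = 0 ∧ y = 0`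
— i.e. `(u, w) ↦ (Sᵀw, Sᵀu)` is BIJECTIVE on `𝒦 ⊕ ⟨(δ, 1)⟩` for any `δ` with `⟨σ_i, δ⟩ = d'_i` — THEN Monsky's odd matrix of `(base, c₁ :: rest, pat)`
is invertible for EVERY mutual pattern `pat`: the design is a pattern-free Heegner recipe with `t = τ + 1` auxiliary primes. By the TRANSVERSALITY
THEOREM (`…SymbolicMonskyTransversal`) such `σ` exist with `τ = τ₀ = s*/2` whenever `𝒦 ⊕ ⟨(δ,1)⟩` (dimension `2τ₀`) meets `V×0`, `0×V` and the
diagonal in dimension `≤ τ₀` — the uniform existence theorem of the companion file `…DesignExists`.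
Proof: semantic closure criterion `SymbData.det_monskyOddS_eq_one_of_staged_constancy` (order `w`, `u`), stages by `design_core`, S3 by `design_S3`.

HONEST FRAMING: RUNG-LEVEL corner layer (congruent `j = 1728` families); a theorem about Monsky matrices, instances still need located primes (doors of
`…PatternFreeDoor` / `…ClosureSymb`, Linnik censuses); the crux as stated (C⁺), its registered stubs and BSD are NOT touched; nothing is closed.
THEOREMS ONLY. Reference: [HeathBrown1994] appendix (Monsky), typescript pp. 39–41.
-/

namespace Summit.BirchSwinnertonDyer.BirchSwinnertonDyer.Theorems.SymbolicMonsky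

section Design

open Matrix

variable {k : ℕ} (base : SymbData (k + 1)) (c₁ : AuxCell) (rest : List AuxCell)

/-- ★★ **THE DESIGN CRITERION** (see the module docstring): under (span) and (inj), Monsky's odd matrix of `(base, c₁ :: rest, pat)` has
`det = 1` for EVERY mutual pattern `pat`. [cite: HeathBrown1994SelmerCongruentII, Appendix (Monsky), typescript p. 39 L27–L33] -/
theorem det_dataK_design_eq_one (hm1 : negNegOne c₁.1 = true) (hmr : ∀ i : Fin rest.length, negNegOne (rest.getD i.val (0, 0)).1 = false)
    (σ : Fin rest.length → Fin (k + 1) → ZMod 2) (hσ : ∀ i b, bz ((rest.getD i.val (0, 0)).2.testBit b.val) = σ i b)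
    (hσ1 : ∀ b : Fin (k + 1), bz (c₁.2.testBit b.val) = bz (negNegOne (base.cls b)) + ∑ i, σ i b)
    (dp : Fin rest.length → ZMod 2) (hdp : ∀ i, bz (negTwo (rest.getD i.val (0, 0)).1) = dp i)
    (hd1 : bz (negTwo c₁.1) = ∑ i, dp i)
    (hspan : ∀ a e : Fin rest.length → ZMod 2,
      (∀ x y : Fin (k + 1) → ZMod 2, (∀ i, (∑ j, bz (base.neg i j) * (x j + x i)) + bz (negNegOne (base.cls i)) * x i + bz (negTwo (base.cls i)) * y i = 0) →
        (∀ i, bz (negNegOne (base.cls i)) * x i + ∑ j, bz (base.neg i j) * (y j + y i) = 0) →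
        (∑ i, (a i * (∑ b, σ i b * y b) + e i * (∑ b, σ i b * x b))) = 0) →
      (∑ i, ((∑ b, σ i b) * a i + dp i * e i)) = 0 → (∀ i, a i = 0) ∧ (∀ i, e i = 0))
    (hF : ∀ (x y : Fin (k + 1) → ZMod 2) (γ : ZMod 2), (∀ i, (∑ j, bz (base.neg i j) * (x j + x i)) + bz (negNegOne (base.cls i)) * x i + bz (negTwo (base.cls i)) * y i = 0) →
        (∀ i, bz (negNegOne (base.cls i)) * x i + ∑ j, bz (base.neg i j) * (y j + y i) = 0) →
        (∀ i, (∑ b, σ i b * x b) + γ * dp i = 0) → (∀ i, (∑ b, σ i b * y b) + γ * ∑ b, σ i b = 0) →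
        γ = 0 ∧ x = 0 ∧ y = 0)
    (pat : ℕ → ℕ → Bool) : (dataK base (c₁ :: rest) pat).monskyOddS.det = 1 := by
  classical
  have h20 : ((2 : ℕ) = 0) = False := by simp
  have h21 : ((2 : ℕ) = 1) = False := by simp
  have auxIdx : ∀ i : Fin (k + 1 + (c₁ :: rest).length), auxQ k (c₁ :: rest).length i = true →
      ∃ j : Fin (c₁ :: rest).length, i = Fin.natAdd (k + 1) j := by
    intro i hi
    induction i using Fin.addCases with
    | left b => rw [auxQ_castAdd] at hi; exact absurd hi (by simp)
    | right j => exact ⟨j, rfl⟩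
  -- from the pattern-independent data of `z`: constancy in the directions `u` and `w`
  have CORE : ∀ z : Fin (k + 1 + (c₁ :: rest).length) ⊕ Fin (k + 1 + (c₁ :: rest).length) → ZMod 2,
      (∀ i, auxQ k (c₁ :: rest).length i = false →
        ((dataK base (c₁ :: rest) (fun _ _ => false)).monskyOddS *ᵥ z) (Sum.inl i) = 0 ∧
        ((dataK base (c₁ :: rest) (fun _ _ => false)).monskyOddS *ᵥ z) (Sum.inr i) = 0) →
      (∑ i ∈ Finset.univ.filter (fun i => auxQ k (c₁ :: rest).length i = true),
        ((dataK base (c₁ :: rest) (fun _ _ => false)).monskyOddS *ᵥ z) (Sum.inl i)) = 0 →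
      (∑ i ∈ Finset.univ.filter (fun i => auxQ k (c₁ :: rest).length i = true),
        ((dataK base (c₁ :: rest) (fun _ _ => false)).monskyOddS *ᵥ z) (Sum.inr i)) = 0 →
      ∀ j j' : Fin (c₁ :: rest).length,
        z (Sum.inl (Fin.natAdd (k + 1) j)) = z (Sum.inl (Fin.natAdd (k + 1) j')) ∧
        z (Sum.inl (Fin.natAdd (k + 1) j)) + z (Sum.inr (Fin.natAdd (k + 1) j)) =
          z (Sum.inl (Fin.natAdd (k + 1) j')) + z (Sum.inr (Fin.natAdd (k + 1) j')) := by
    intro z hout hs1 hs2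
    rw [sum_filter_auxQ] at hs1 hs2
    obtain ⟨hu, hw, -, -, -⟩ := design_core base c₁ rest hm1 hmr σ hσ hσ1 dp hdp hd1 hspan z
      (fun b => (hout _ (auxQ_castAdd _ b)).1) (fun b => (hout _ (auxQ_castAdd _ b)).2) hs1 hs2
    -- every auxiliary index agrees with q₁
    have hu0 : ∀ j : Fin (c₁ :: rest).length, z (Sum.inl (Fin.natAdd (k + 1) j)) =
        z (Sum.inl (Fin.natAdd (k + 1) (⟨0, by simp⟩ : Fin (c₁ :: rest).length))) := by
      intro j
      rcases fin_cons_cases c₁ rest j with rfl | ⟨i, rfl⟩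
      · rfl
      · exact hu i
    have hw0 : ∀ j : Fin (c₁ :: rest).length, z (Sum.inl (Fin.natAdd (k + 1) j)) + z (Sum.inr (Fin.natAdd (k + 1) j)) =
        z (Sum.inl (Fin.natAdd (k + 1) (⟨0, by simp⟩ : Fin (c₁ :: rest).length))) +
          z (Sum.inr (Fin.natAdd (k + 1) (⟨0, by simp⟩ : Fin (c₁ :: rest).length))) := by
      intro j
      rcases fin_cons_cases c₁ rest j with rfl | ⟨i, rfl⟩
      · rfl
      · exact hw i
    intro j j'
    exact ⟨(hu0 j).trans (hu0 j').symm, (hw0 j).trans (hw0 j').symm⟩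
  refine SymbData.det_monskyOddS_eq_one_of_staged_constancy (agreeOffAux_dataK base (c₁ :: rest) (fun _ _ => false) pat)
    (δ₁ := 2) (δ₂ := 0) (by omega) (by omega) (by omega) ?_ ?_ ?_
  · -- stage one, direction w
    intro z hout hs1 hs2 i j hi hj
    simp only [h20, h21, if_false]
    obtain ⟨i', rfl⟩ := auxIdx i hi
    obtain ⟨j', rfl⟩ := auxIdx j hj
    exact (CORE z hout hs1 hs2 i' j').2
  · -- stage two, direction u
    intro z hout hs1 hs2 _ i j hi hj
    simp only [if_true]
    obtain ⟨i', rfl⟩ := auxIdx i hi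
    obtain ⟨j', rfl⟩ := auxIdx j hj
    exact (CORE z hout hs1 hs2 i' j').1
  · -- stage three
    intro z hconst hz
    exact design_S3 base c₁ rest hm1 hmr σ hσ hσ1 dp hdp hd1 hF z hconst hz

/-- ★★ **Packaged form of the design criterion**: the design passes the general-`k` Heegner check and wins for every mutual pattern — a
pattern-free Heegner recipe with `τ + 1` auxiliary primes. [cite: HeathBrown1994SelmerCongruentII, Appendix (Monsky), typescript p. 39 L27–L33] -/
theorem design_recipe (hm1 : negNegOne c₁.1 = true) (hmr : ∀ i : Fin rest.length, negNegOne (rest.getD i.val (0, 0)).1 = false)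
    (σ : Fin rest.length → Fin (k + 1) → ZMod 2) (hσ : ∀ i b, bz ((rest.getD i.val (0, 0)).2.testBit b.val) = σ i b)
    (hσ1 : ∀ b : Fin (k + 1), bz (c₁.2.testBit b.val) = bz (negNegOne (base.cls b)) + ∑ i, σ i b)
    (dp : Fin rest.length → ZMod 2) (hdp : ∀ i, bz (negTwo (rest.getD i.val (0, 0)).1) = dp i)
    (hd1 : bz (negTwo c₁.1) = ∑ i, dp i)
    (hspan : ∀ a e : Fin rest.length → ZMod 2,
      (∀ x y : Fin (k + 1) → ZMod 2, (∀ i, (∑ j, bz (base.neg i j) * (x j + x i)) + bz (negNegOne (base.cls i)) * x i + bz (negTwo (base.cls i)) * y i = 0) →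
        (∀ i, bz (negNegOne (base.cls i)) * x i + ∑ j, bz (base.neg i j) * (y j + y i) = 0) →
        (∑ i, (a i * (∑ b, σ i b * y b) + e i * (∑ b, σ i b * x b))) = 0) →
      (∑ i, ((∑ b, σ i b) * a i + dp i * e i)) = 0 → (∀ i, a i = 0) ∧ (∀ i, e i = 0))
    (hF : ∀ (x y : Fin (k + 1) → ZMod 2) (γ : ZMod 2), (∀ i, (∑ j, bz (base.neg i j) * (x j + x i)) + bz (negNegOne (base.cls i)) * x i + bz (negTwo (base.cls i)) * y i = 0) →
        (∀ i, bz (negNegOne (base.cls i)) * x i + ∑ j, bz (base.neg i j) * (y j + y i) = 0) →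
        (∀ i, (∑ b, σ i b * x b) + γ * dp i = 0) → (∀ i, (∑ b, σ i b * y b) + γ * ∑ b, σ i b = 0) →
        γ = 0 ∧ x = 0 ∧ y = 0) :
    heegnerK base (c₁ :: rest) = true ∧ ∀ pat : ℕ → ℕ → Bool, (dataK base (c₁ :: rest) pat).monskyOddS.det = 1 := by
  refine ⟨heegnerK_design base c₁ rest hm1 hmr ?_ ?_, fun pat => det_dataK_design_eq_one base c₁ rest hm1 hmr σ hσ hσ1 dp hdp hd1 hspan hF pat⟩
  · rw [hd1]; exact Finset.sum_congr rfl fun i _ => (hdp i).symm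
  · intro b; rw [hσ1 b]; exact congrArg _ (Finset.sum_congr rfl fun i _ => (hσ i b).symm)

end Design

end Summit.BirchSwinnertonDyer.BirchSwinnertonDyer.Theorems.SymbolicMonsky
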